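import Mathlib.MeasureTheory.Measure.Hausdorff
import Literature.MathematicalPhysics.StatisticalMechanics.WulffCrystalGammaLimit
import Literature.MathematicalPhysics.StatisticalMechanics.LatticeMaximalFluctuations
import HarnessLib

/-!
# `Γ`-convergence of nearest-neighbour surface energies on general periodic point sets in `ℝ³`
# (Cicalese–Kreutz–Leonardi 2023, §5: Proposition 5.10, Lemma 5.11, Theorem 5.14)

Topic `Literature/MathematicalPhysics/StatisticalMechanics` (namespace = path, grouping sub-namespace
`CicaleseKreutzLeonardi2023` for the §5 vocabulary); fourth file on M. Cicalese, L. Kreutz,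
G. P. Leonardi, *Emergence of Wulff-crystals from atomistic systems on the FCC and HCP lattices*,
Comm. Math. Phys. **402** (2023) 2931–2978 = arXiv:2204.12892 [CicaleseKreutzLeonardi2023] (held arXiv
text `paper:cicalese2023-emergence-wulff-crystals-from-atomistic-systems-fcc`; page numbers below are
arXiv pages), after `StickyWulffConstants.lean`, `WulffCrystalEmergence.lean` and
`WulffCrystalGammaLimit.lean` (Theorem 2.3 for `L_FCC`, `L_HCP`, with the EXPLICIT densities).  Those
files list "§5 general periodic-lattice theory (Thm 5.14)" as not typed.  This file types it, for
`n = 3` and `A = ℝ³`: an ADMISSIBLE PERIODIC point set `L ⊂ ℝ³` (Definitions 5.1, 5.8 — Bravais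
lattices and multilattices alike, e.g. every periodic close-packed stacking), nearest neighbours in the
VORONOI sense (Definition 5.2), bounded bond weights `c_nn` (73), the rescaled empirical measures (74)
with the density `ρ = #(L ∩ Q)/|Q|` (76), and the `Γ`-limit `∫_{∂*V} φ_hom(ν) dH²` with `φ_hom` given by
the asymptotic cell formula of Theorem 5.14 — rendered, as in `WulffCrystalGammaLimit.lean`, over the
distributional anisotropic perimeter `Literature.Analysis.Convexity.anisotropicPerimeter (wulffSet φ) V`.
Cross-ladder literature-typing layer (D-0088 (4)), cell `crystal3d-full`, seat `littype-FC1-2`; consumer: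
the periodic-word case of the crux `StackingLiminf` of `Summit.Ventures.Crystal3D.Theses.StickyWulffConstant`
(a periodic Barlow stacking is an admissible periodic set; that its Voronoi neighbours are its twelve
contact neighbours is proved in the source only for fcc and hcp, Lemmas 4.1–4.2, and is NOT asserted here).

## Source, as printed (arXiv pages)

* p. 4: "For any `ν ∈ S^{n−1}` let `{ν₁, …, ν_n = ν}` be an orthonormal basis of `ℝⁿ`, and let
  `Q^ν := {x ∈ ℝⁿ : |⟨x, ν_i⟩| < 1/2, i = 1,…,n}` be a unit cube centered at the origin with faces
  parallel and orthogonal to `ν`. For `T > 0` … `Q^ν_T = TQ^ν`"; "`μ_k ⇀* μ` if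
  `lim_k ∫_A ϕ dμ_k = ∫_A ϕ dμ` for all `ϕ ∈ C_c(A)`"; (5): "`u_ν(i) := 1` if `⟨x, ν⟩ ≥ 0`; `0` otherwise."
* p. 26, **Definition 5.1.** "Let `Σ ⊂ ℝⁿ` be a countable set of points in `ℝⁿ`. We call `Σ` an admissible
  set of points if the following two conditions hold: (L1) There exists `R > 0` such that
  `inf_{x∈ℝⁿ} #(Σ ∩ B_R(x)) ≥ 1`; (L2) There exists `r > 0` such that `dist(x, Σ ∖ {x}) ≥ r` for all
  `x ∈ Σ`."  **Definition 5.2.** "`V(x) := {z ∈ ℝⁿ : |x − z| ≤ |y − z| for all y ∈ Σ}` (70).  The set of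
  nearest neighbors of `Σ` is defined by `NN(Σ) := {(x, y) ∈ Σ × Σ : H^{n−1}(V(x) ∩ V(y)) > 0}` … `εΣ := {εx}`,
  `V_ε(x) = εV(ε⁻¹x)`, `NN_ε(x)`."  (71): "`F_ε(u, A) := Σ_{(x,y) ∈ NN(Σ), εx ∈ A} ε^{n−1} c_nn(x − y) |u(εx) − u(εy)|`"
  for `u : Σ_ε → {0,1}`, where (73) "`C⁻¹ ≤ c_nn(x) ≤ C` for all `x ∈ ℝⁿ`"; p. 27: "Given `X ⊂ εΣ` we write
  with a slight abuse of notation `F_ε(X, A) = F_ε(χ_X, A)`."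
* p. 27, **Definition 5.4.** "Given `X ⊂ εL` we define the rescaled empirical measures associated to `X` as
  `μ_ε = εⁿ Σ_{x∈X} δ_x` (74)."  p. 28, **Definition 5.8.** "Let `L ⊂ ℝⁿ` be an admissible set of points. We
  say that `L` is periodic if there exists a basis `{e₁, …, e_n} ⊂ ℝⁿ` such that `L + e_k = L` for all
  `k = 1, …, n`. We denote by `Q := {Σ_k λ_k e_k : 0 ≤ λ_k < 1}` the periodicity cell of `L`. We set
  `ρ := #(L ∩ Q)/|Q|` (76)."
* p. 30, **Proposition 5.10 (Compactness of the piecewise-constant interpolants).** "Let `L` be an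
  admissible periodic set of points and `F_ε` defined in (71) with `L` in place of `Σ`. Let `A ⊂ ℝⁿ` be
  open and let `{X_ε}_ε ⊂ εL` be such that `sup_{ε>0} F_ε(X_ε, A) < +∞`. Then there exists a set of finite
  perimeter `V ⊂ A` and a subsequence (not relabeled) such that `χ_{V_ε} → χ_V` with respect to the
  strong `L¹_loc(A)`-topology."  **Lemma 5.11 (Equivalence of convergences).** "… let `V ⊂ A` be a set of
  finite perimeter and let `{X_ε} ⊂ εL` … `sup_ε F_ε(X_ε, A) < +∞` (79). Then … the following are
  equivalent: (i) `μ_ε ⇀* μ` with respect to the weak star topology of measures and `μ = ρ𝓛ⁿ⌞V`.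
  (ii) `χ_{V_ε} → χ_V` with respect to the strong `L¹_loc(A)`-topology."
* p. 33, **Theorem 5.14 (`Γ`-convergence for periodic admissible lattices).** "Let `L` be an admissible
  periodic set of points and let `F_ε` be defined by (71) with `L` in place of `Σ`. Let `A ⊂ ℝⁿ` be
  bounded open set with `∂A ∈ Lip` or `A = ℝⁿ`. The functionals `F_ε` `Γ`-converge with respect to
  weak* convergence of measures to the functional `F_hom : M₊(A) → [0, +∞]` defined by
  `F_hom(μ, A) := ∫_{∂*V ∩ A} φ_hom(ν) dH^{n−1}` if `μ = ρ𝓛ⁿ⌞V`; `+∞` otherwise.  The function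
  `φ_hom : ℝⁿ → [0, +∞]` is given by
  `φ_hom(ν) = lim_{T→+∞} T^{1−n} inf{F(X, Q^ν_T) : X ⊂ L, χ_X(i) = u_ν(i) for i ∈ L ∖ Q^ν_{T−l_T}}`,
  where `l_T → +∞` and `l_T/T → 0` as `T → +∞`."  (p. 7: "we say that `F_ε` `Γ`-converges to `F` if for
  all sequences `{ε_j}_j` converging to `0` we have `Γ-lim_j F_{ε_j} = F`.")

## Rendering

* `n = 3`, `A = ℝ³` only (`-- TODO(general form): ℝⁿ and bounded Lipschitz `A``).  `E3 = EuclideanSpace ℝ (Fin 3)`.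
* Occupancies are UNSCALED: `X ⊆ L` stands for the scaled configuration `εX ⊂ εL`; then
  `F_ε(εX, ℝ³) = ε² · Σ_{(x,y) ∈ NN(L)} c_nn(x − y) |χ_X(x) − χ_X(y)|` (`scaledNNEnergy`, an `ℝ≥0∞`-valued
  `tsum` over ORDERED pairs, as (71)), `F(X, Q^ν_T) = F₁(X, Q^ν_T)` is `localNNEnergy` (pairs with
  `x ∈ Q^ν_T`), and `∫ g dμ_ε = ε³ Σ_{x∈X} g(εx)` is the tree's `empiricalPairing ε X g`
  (`WulffCrystalGammaLimit.lean`); `μ_{ε_k} ⇀* ρ𝓛³⌞V` is `EmpiricalMeasuresWeakStarToDensity X ε ρ V`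
  (for `ρ = √2` the tree's `EmpiricalMeasuresWeakStarTo`, `Iff.rfl`).
* The Voronoi cell (70) is the tree's `CicaleseLeonardi2020.latticeVoronoiCell`
  (`LatticeMaximalFluctuations.lean`, same formula); `H²` is Mathlib's Hausdorff measure `μH[2]`.
* The orthonormal basis `{ν₁, ν₂, ν₃ = ν}` behind `Q^ν` ("let … be an orthonormal basis", otherwise
  unspecified) and the boundary-layer width `l_T` ("where `l_T → +∞` and `l_T/T → 0`") are quantified
  UNIVERSALLY: the cell formula is asserted for every such choice.
* `∫_{∂*V} φ_hom(ν) dH²` for `μ = ρ𝓛³⌞V`, `χ_V ∈ BV_loc`, is rendered — exactly as in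
  `WulffCrystalGammaLimit.lean` — by `anisotropicPerimeter (wulffSet φ_hom) V` (`= sup{∫_V div T :
  T ∈ C¹_c, T(x) ∈ W̄_φ}`, Maggi (20.2)/(20.26)); `φ_hom` itself is bound EXISTENTIALLY in the named fact
  (it is characterised there by the cell formula), so no choice enters a definition.
* `F_ε` "`Γ`-converges with respect to weak* convergence" (for all `ε_k → 0`): (liminf) along any
  `μ_{ε_k}(X_k) ⇀* ρ𝓛³⌞V`, `P_{W_{φ_hom}}(V) ≤ liminf_k F_{ε_k}(X_k)`; (limsup) every measurable `V` with
  `P_{W_{φ_hom}}(V) < ∞` is the weak* limit of occupancies with `liminf_k F_{ε_k}(X_k) ≤ P_{W_{φ_hom}}(V)`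
  (both in `[0, ∞]`; as in the earlier file, the `+∞` branches of `F_hom` carry no information about
  occupancies and are not restated).

## What is here

Definitions with bodies: `IsAdmissibleSet` (Def. 5.1), `IsVoronoiNeighbour` (Def. 5.2), `IsPeriodicSet`,
`periodicityCell`, `density` (Def. 5.8, (76)), `IsBoundedCoeff` (73), `nnEnergy`, `scaledNNEnergy`,
`localNNEnergy` (71), `halfspaceOccupancy` (5), `onbCube` (`Q^ν_T`), `cellInf` (the infimum in
Theorem 5.14), `EmpiricalMeasuresWeakStarToDensity` (74) + weak*, `PeriodicLatticeLiminf`,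
`PeriodicLatticeLimsup`, `CellFormulaHolds`.  Proved: `empiricalMeasuresWeakStarToDensity_sqrt_two_iff`
(bridge to the fcc/hcp file), `isVoronoiNeighbour_symm`, `nnEnergy_empty`.  NAMED FACTS:
`CicaleseKreutzLeonardi2023_periodicCompactness` (Prop. 5.10 with Lemma 5.11),
`CicaleseKreutzLeonardi2023_periodicGammaLimit` (Thm 5.14).

## What is not here

Theorem 5.7 (the stochastic-lattice integral representation of [3] = Alicandro–Cicalese–Ruf), the
bounded-domain case `A ≠ ℝⁿ`, Lemma 5.9, Corollary 5.12, Lemma 5.15; the identification of `φ_hom`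
with a one-period cell formula (the source's Proposition 2.1 is stated for `L_FCC`/`L_HCP`; the
general finite cell formula is Chambolle–Kreutz 2023, Prop. 2.6, typed in
`CrystallineSurfaceDensity.lean` for `Tℤ^d`-periodic systems); and the fact that the Voronoi neighbours of
a close-packed stacking are its twelve contacts (printed for fcc/hcp only).  No instances, no notation,
no `sorry`.
-/

noncomputable section

open scoped InnerProductSpace ENNReal Topology
open MeasureTheory Filter Set

namespace Literature.MathematicalPhysics.StatisticalMechanics.CicaleseKreutzLeonardi2023

open Literature.Analysis.Convexity (anisotropicPerimeter)
open Literature.MathematicalPhysics.StatisticalMechanics.CicaleseLeonardi2020 (latticeVoronoiCell)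

/-! ### §1 Admissible and periodic point sets, Voronoi neighbours (Definitions 5.1, 5.2, 5.8) -/

/-- **Definition 5.1 (admissible set of points):** countable, (L1) every ball of radius `R` meets `Σ`
(`inf_x #(Σ ∩ B_R(x)) ≥ 1`), (L2) uniformly discrete. [cite: CicaleseKreutzLeonardi2023, Definition 5.1 p. 26] -/
def IsAdmissibleSet (S : Set (EuclideanSpace ℝ (Fin 3))) : Prop :=
  S.Countable ∧ (∃ R : ℝ, 0 < R ∧ ∀ x : EuclideanSpace ℝ (Fin 3), (S ∩ Metric.ball x R).Nonempty) ∧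
    ∃ r : ℝ, 0 < r ∧ ∀ x ∈ S, ∀ y ∈ S, x ≠ y → r ≤ dist x y

/-- **Definition 5.2 (nearest neighbours):** `(x, y) ∈ NN(Σ)` iff `x, y ∈ Σ` and their Voronoi cells (70)
(the tree's `latticeVoronoiCell`) share a facet of positive `H²`-measure.
[cite: CicaleseKreutzLeonardi2023, Definition 5.2 (70) p. 26] -/
def IsVoronoiNeighbour (S : Set (EuclideanSpace ℝ (Fin 3))) (x y : EuclideanSpace ℝ (Fin 3)) : Prop :=
  x ∈ S ∧ y ∈ S ∧ 0 < μH[2] (latticeVoronoiCell S x ∩ latticeVoronoiCell S y)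

/-- The neighbour relation is symmetric. [cite: CicaleseKreutzLeonardi2023, Definition 5.2 p. 26] -/
theorem isVoronoiNeighbour_symm {S : Set (EuclideanSpace ℝ (Fin 3))} {x y : EuclideanSpace ℝ (Fin 3)}
    (h : IsVoronoiNeighbour S x y) : IsVoronoiNeighbour S y x :=
  ⟨h.2.1, h.1, by rw [Set.inter_comm]; exact h.2.2⟩

/-- **Definition 5.8 (periodic set):** `L + e_k = L` for a basis `e₁, e₂, e₃` of `ℝ³`.
[cite: CicaleseKreutzLeonardi2023, Definition 5.8 p. 28] -/
def IsPeriodicSet (L : Set (EuclideanSpace ℝ (Fin 3))) (e : Fin 3 → EuclideanSpace ℝ (Fin 3)) : Prop :=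
  LinearIndependent ℝ e ∧ ∀ (k : Fin 3) (x : EuclideanSpace ℝ (Fin 3)), x ∈ L ↔ x + e k ∈ L

/-- The periodicity cell `Q = {Σ_k λ_k e_k : 0 ≤ λ_k < 1}`. [cite: CicaleseKreutzLeonardi2023, Definition 5.8 p. 28] -/
def periodicityCell (e : Fin 3 → EuclideanSpace ℝ (Fin 3)) : Set (EuclideanSpace ℝ (Fin 3)) :=
  {x | ∃ lam : Fin 3 → ℝ, (∀ k, 0 ≤ lam k ∧ lam k < 1) ∧ x = ∑ k, lam k • e k}

/-- The number density `ρ = #(L ∩ Q)/|Q|` (76). [cite: CicaleseKreutzLeonardi2023, (76) p. 28] -/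
def density (L : Set (EuclideanSpace ℝ (Fin 3))) (e : Fin 3 → EuclideanSpace ℝ (Fin 3)) : ℝ :=
  ((L ∩ periodicityCell e).ncard : ℝ) / (volume (periodicityCell e)).toReal

/-- (73): the nearest-neighbour weights satisfy `C⁻¹ ≤ c_nn(v) ≤ C` for all `v`.
[cite: CicaleseKreutzLeonardi2023, (73) p. 26] -/
def IsBoundedCoeff (C : ℝ) (cnn : EuclideanSpace ℝ (Fin 3) → ℝ) : Prop :=
  0 < C ∧ ∀ v, C⁻¹ ≤ cnn v ∧ cnn v ≤ C

/-! ### §2 The energies (71), cubes and the cell problem of Theorem 5.14 -/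

/-- `F₁(χ_X, ℝ³) = Σ_{(x,y) ∈ NN(L)} c_nn(x − y) |χ_X(x) − χ_X(y)|` for an occupancy `X` (sites of `L`; sites
outside `L` are ignored): the total weight of the ORDERED Voronoi bonds of `L` broken by `X`, in `[0, ∞]`.
[cite: CicaleseKreutzLeonardi2023, (71) p. 26 (with `A = ℝⁿ`, `ε = 1`) and p. 27 (`F_ε(X, A) = F_ε(χ_X, A)`)] -/
def nnEnergy (L : Set (EuclideanSpace ℝ (Fin 3))) (cnn : EuclideanSpace ℝ (Fin 3) → ℝ)
    (X : Set (EuclideanSpace ℝ (Fin 3))) : ℝ≥0∞ :=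
  ∑' p : L × L,
    {q : L × L | IsVoronoiNeighbour L q.1 q.2 ∧
        ((q.1 : EuclideanSpace ℝ (Fin 3)) ∈ X ↔ (q.2 : EuclideanSpace ℝ (Fin 3)) ∉ X)}.indicator
      (fun q => ENNReal.ofReal (cnn ((q.1 : EuclideanSpace ℝ (Fin 3)) - q.2))) p

/-- **The surface-scaled energy** `F_ε(χ_{εX}, ℝ³) = ε² Σ_{(x,y)∈NN(L)} c_nn(x − y)|χ_X(x) − χ_X(y)|` of the
scaled occupancy `εX ⊂ εL`. [cite: CicaleseKreutzLeonardi2023, (71) p. 26 (`n = 3`, `A = ℝ³`)] -/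
def scaledNNEnergy (ε : ℝ) (L : Set (EuclideanSpace ℝ (Fin 3))) (cnn : EuclideanSpace ℝ (Fin 3) → ℝ)
    (X : Set (EuclideanSpace ℝ (Fin 3))) : ℝ≥0∞ :=
  ENNReal.ofReal (ε ^ 2) * nnEnergy L cnn X

/-- The localized energy at `ε = 1`, `F(X, A) = Σ_{(x,y)∈NN(L), x ∈ A} c_nn(x − y)|χ_X(x) − χ_X(y)|` (only
bonds issuing from `A`). [cite: CicaleseKreutzLeonardi2023, (71) p. 26 and Remark 5.3 p. 27] -/
def localNNEnergy (L : Set (EuclideanSpace ℝ (Fin 3))) (cnn : EuclideanSpace ℝ (Fin 3) → ℝ)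
    (X A : Set (EuclideanSpace ℝ (Fin 3))) : ℝ≥0∞ :=
  ∑' p : L × L,
    {q : L × L | IsVoronoiNeighbour L q.1 q.2 ∧ (q.1 : EuclideanSpace ℝ (Fin 3)) ∈ A ∧
        ((q.1 : EuclideanSpace ℝ (Fin 3)) ∈ X ↔ (q.2 : EuclideanSpace ℝ (Fin 3)) ∉ X)}.indicator
      (fun q => ENNReal.ofReal (cnn ((q.1 : EuclideanSpace ℝ (Fin 3)) - q.2))) p

/-- The empty occupancy breaks no bond. [cite: CicaleseKreutzLeonardi2023, (71) p. 26] -/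
theorem nnEnergy_empty (L : Set (EuclideanSpace ℝ (Fin 3))) (cnn : EuclideanSpace ℝ (Fin 3) → ℝ) :
    nnEnergy L cnn ∅ = 0 := by
  unfold nnEnergy
  simp

/-- The half-space occupancy `{u_ν = 1} = {i : ⟨i, ν⟩ ≥ 0}` (5). [cite: CicaleseKreutzLeonardi2023, (5) p. 4] -/
def halfspaceOccupancy (ν : EuclideanSpace ℝ (Fin 3)) : Set (EuclideanSpace ℝ (Fin 3)) :=
  {i | 0 ≤ ⟪i, ν⟫_ℝ}

/-- The open cube `Q^ν_T = T·{x : |⟨x, ν_i⟩| < 1/2, i = 1,2,3}` for an orthonormal basis `b = (ν₁, ν₂, ν₃)`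
(with `ν₃ = ν` in the source). [cite: CicaleseKreutzLeonardi2023, p. 4 (definition of `Q^ν`, `Q^ν_T`)] -/
def onbCube (b : OrthonormalBasis (Fin 3) ℝ (EuclideanSpace ℝ (Fin 3))) (T : ℝ) :
    Set (EuclideanSpace ℝ (Fin 3)) :=
  {x | ∀ i, |⟪x, b i⟫_ℝ| < T / 2}

/-- The infimum in Theorem 5.14:
`inf{F(X, Q^ν_T) : X ⊂ L, χ_X(i) = u_ν(i) for i ∈ L ∖ Q^ν_{T − l}}` (boundary layer of width `l`).
[cite: CicaleseKreutzLeonardi2023, Theorem 5.14 p. 33] -/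
def cellInf (L : Set (EuclideanSpace ℝ (Fin 3))) (cnn : EuclideanSpace ℝ (Fin 3) → ℝ)
    (b : OrthonormalBasis (Fin 3) ℝ (EuclideanSpace ℝ (Fin 3))) (T l : ℝ) : ℝ≥0∞ :=
  sInf ((fun X => localNNEnergy L cnn X (onbCube b T)) ''
    {X | X ⊆ L ∧ ∀ i ∈ L, i ∉ onbCube b (T - l) → (i ∈ X ↔ i ∈ halfspaceOccupancy (b 2))})

/-! ### §3 Empirical measures with density `ρ`; the `Γ`-limit clauses -/

/-- **`μ_{ε_k}(X_k) ⇀* ρ𝓛³⌞V`**: `ε_k³ Σ_{x∈X_k} g(ε_k x) → ρ ∫_V g` for every continuous compactly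
supported `g` ((74) and the weak* convergence of p. 4; the pairing is the tree's `empiricalPairing`).
[cite: CicaleseKreutzLeonardi2023, (74) p. 27; p. 4 (weak star); Lemma 5.11 (i) p. 30] -/
def EmpiricalMeasuresWeakStarToDensity (X : ℕ → Set (EuclideanSpace ℝ (Fin 3))) (ε : ℕ → ℝ) (ρ : ℝ)
    (V : Set (EuclideanSpace ℝ (Fin 3))) : Prop :=
  ∀ g : EuclideanSpace ℝ (Fin 3) → ℝ, Continuous g → HasCompactSupport g →
    Tendsto (fun k => empiricalPairing (ε k) (X k) g) atTop (𝓝 (ρ * ∫ y in V, g y))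

/-- For `ρ = √2` this is the convergence notion of `WulffCrystalGammaLimit.lean` (fcc/hcp), by `rfl`.
[cite: CicaleseKreutzLeonardi2023, (74) p. 27 and (17) p. 7] -/
theorem empiricalMeasuresWeakStarToDensity_sqrt_two_iff (X : ℕ → Set (EuclideanSpace ℝ (Fin 3)))
    (ε : ℕ → ℝ) (V : Set (EuclideanSpace ℝ (Fin 3))) :
    EmpiricalMeasuresWeakStarToDensity X ε (Real.sqrt 2) V ↔ EmpiricalMeasuresWeakStarTo X ε V :=
  Iff.rfl

/-- **Liminf clause of Theorem 5.14 (`A = ℝ³`)** for the host `L`, weights `c_nn`, density `ρ` and limit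
density `φ`: along every `μ_{ε_k}(X_k) ⇀* ρ𝓛³⌞V` (`X_k ⊆ L`, `V` measurable),
`∫_{∂*V} φ(ν) dH² = P_{W_φ}(V) ≤ liminf_k F_{ε_k}(ε_k X_k)`.
[cite: CicaleseKreutzLeonardi2023, Theorem 5.14 p. 33] -/
def PeriodicLatticeLiminf (L : Set (EuclideanSpace ℝ (Fin 3))) (cnn : EuclideanSpace ℝ (Fin 3) → ℝ)
    (ρ : ℝ) (φ : EuclideanSpace ℝ (Fin 3) → ℝ) : Prop :=
  ∀ (ε : ℕ → ℝ) (X : ℕ → Set (EuclideanSpace ℝ (Fin 3))) (V : Set (EuclideanSpace ℝ (Fin 3))),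
    (∀ k, 0 < ε k) → Tendsto ε atTop (𝓝 0) → (∀ k, X k ⊆ L) → MeasurableSet V →
    EmpiricalMeasuresWeakStarToDensity X ε ρ V →
      anisotropicPerimeter (wulffSet φ) V ≤ liminf (fun k => scaledNNEnergy (ε k) L cnn (X k)) atTop

/-- **Limsup (recovery) clause of Theorem 5.14 (`A = ℝ³`)**: every measurable `V` with `P_{W_φ}(V) < ∞` is
the weak* limit `μ_{ε_k}(X_k) ⇀* ρ𝓛³⌞V` of occupancies `X_k ⊆ L` with
`liminf_k F_{ε_k}(ε_k X_k) ≤ P_{W_φ}(V)`, for every sequence `ε_k → 0`.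
[cite: CicaleseKreutzLeonardi2023, Theorem 5.14 p. 33; p. 7 (`Γ`-convergence along all `ε_j → 0`)] -/
def PeriodicLatticeLimsup (L : Set (EuclideanSpace ℝ (Fin 3))) (cnn : EuclideanSpace ℝ (Fin 3) → ℝ)
    (ρ : ℝ) (φ : EuclideanSpace ℝ (Fin 3) → ℝ) : Prop :=
  ∀ (ε : ℕ → ℝ) (V : Set (EuclideanSpace ℝ (Fin 3))), (∀ k, 0 < ε k) → Tendsto ε atTop (𝓝 0) →
    MeasurableSet V → anisotropicPerimeter (wulffSet φ) V < ∞ →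
      ∃ X : ℕ → Set (EuclideanSpace ℝ (Fin 3)), (∀ k, X k ⊆ L) ∧
        EmpiricalMeasuresWeakStarToDensity X ε ρ V ∧
          liminf (fun k => scaledNNEnergy (ε k) L cnn (X k)) atTop ≤ anisotropicPerimeter (wulffSet φ) V

/-- **The cell formula of Theorem 5.14** for the density `φ`: for every unit `ν`, every orthonormal basis
`(ν₁, ν₂, ν₃ = ν)` and every boundary-layer width `l_T → +∞` with `l_T/T → 0`,
`T^{−2} inf{F(X, Q^ν_T) : X ⊂ L, χ_X = u_ν on L ∖ Q^ν_{T−l_T}} → φ(ν)` as `T → +∞`.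
[cite: CicaleseKreutzLeonardi2023, Theorem 5.14 p. 33 (formula for `φ_hom`)] -/
def CellFormulaHolds (L : Set (EuclideanSpace ℝ (Fin 3))) (cnn : EuclideanSpace ℝ (Fin 3) → ℝ)
    (φ : EuclideanSpace ℝ (Fin 3) → ℝ) : Prop :=
  ∀ (ν : EuclideanSpace ℝ (Fin 3)), ‖ν‖ = 1 →
    ∀ b : OrthonormalBasis (Fin 3) ℝ (EuclideanSpace ℝ (Fin 3)), b 2 = ν →
      ∀ l : ℝ → ℝ, Tendsto l atTop atTop → Tendsto (fun T => l T / T) atTop (𝓝 0) →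
        Tendsto (fun T : ℝ => ENNReal.ofReal ((T ^ 2)⁻¹) * cellInf L cnn b T (l T)) atTop
          (𝓝 (ENNReal.ofReal (φ ν)))

/-! ### §4 The named facts -/

/-- **Cicalese–Kreutz–Leonardi 2023, Proposition 5.10 with Lemma 5.11 (compactness, weak* form, `A = ℝ³`),
NAMED FACT.**  For an admissible periodic point set `L ⊂ ℝ³` (basis `e`, density `ρ = #(L∩Q)/|Q|`) and
weights `C⁻¹ ≤ c_nn ≤ C`: every sequence of occupancies `X_k ⊆ L` at scales `ε_k → 0` with
`sup_k F_{ε_k}(ε_k X_k) < +∞` has a subsequence whose rescaled empirical measures converge weakly-star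
to `ρ𝓛³⌞V` for a set `V` of finite perimeter (Prop. 5.10 gives `χ_{V_ε} → χ_V` in `L¹_loc` for the
Voronoi interpolants, Lemma 5.11 the equivalence with `μ_ε ⇀* ρ𝓛³⌞V`).
[cite: CicaleseKreutzLeonardi2023, Proposition 5.10 p. 30; Lemma 5.11 p. 30; (76) p. 28] -/
def CicaleseKreutzLeonardi2023_periodicCompactness : Prop :=
  ∀ (L : Set (EuclideanSpace ℝ (Fin 3))) (e : Fin 3 → EuclideanSpace ℝ (Fin 3)) (C : ℝ)
    (cnn : EuclideanSpace ℝ (Fin 3) → ℝ), IsAdmissibleSet L → IsPeriodicSet L e → IsBoundedCoeff C cnn →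
    ∀ (ε : ℕ → ℝ) (X : ℕ → Set (EuclideanSpace ℝ (Fin 3))), (∀ k, 0 < ε k) → Tendsto ε atTop (𝓝 0) →
      (∀ k, X k ⊆ L) → (⨆ k, scaledNNEnergy (ε k) L cnn (X k)) < ∞ →
        ∃ V : Set (EuclideanSpace ℝ (Fin 3)), HasFinitePerimeter V ∧
          ∃ φ : ℕ → ℕ, StrictMono φ ∧ EmpiricalMeasuresWeakStarToDensity (X ∘ φ) (ε ∘ φ) (density L e) V

/-- **Cicalese–Kreutz–Leonardi 2023, Theorem 5.14 (`Γ`-convergence for periodic admissible lattices;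
`n = 3`, `A = ℝ³`), NAMED FACT.**  For an admissible periodic point set `L ⊂ ℝ³` (basis `e`, density `ρ`)
and weights `C⁻¹ ≤ c_nn ≤ C` there is a density `φ_hom : ℝ³ → ℝ`, given on unit vectors by the cell
formula `φ_hom(ν) = lim_T T^{−2} inf{F(X, Q^ν_T) : X ⊂ L, χ_X = u_ν on L ∖ Q^ν_{T−l_T}}` (any orthonormal
frame with `ν₃ = ν`, any `l_T → ∞` with `l_T/T → 0`), such that the scaled energies `F_ε` `Γ`-converge,
with respect to weak* convergence of the rescaled empirical measures, to `∫_{∂*V} φ_hom(ν) dH²` at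
`μ = ρ𝓛³⌞V` (liminf and recovery clauses, the limit functional rendered as `P_{W_{φ_hom}}(V)`).
[cite: CicaleseKreutzLeonardi2023, Theorem 5.14 p. 33; (71) p. 26; (74) p. 27; (76) p. 28] -/
def CicaleseKreutzLeonardi2023_periodicGammaLimit : Prop :=
  ∀ (L : Set (EuclideanSpace ℝ (Fin 3))) (e : Fin 3 → EuclideanSpace ℝ (Fin 3)) (C : ℝ)
    (cnn : EuclideanSpace ℝ (Fin 3) → ℝ), IsAdmissibleSet L → IsPeriodicSet L e → IsBoundedCoeff C cnn →
    ∃ φhom : EuclideanSpace ℝ (Fin 3) → ℝ, (∀ ν, 0 ≤ φhom ν) ∧ CellFormulaHolds L cnn φhom ∧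
      PeriodicLatticeLiminf L cnn (density L e) φhom ∧ PeriodicLatticeLimsup L cnn (density L e) φhom

/-! ### §5 Consequence: the liminf inequality in the cell's finite-cluster vocabulary (PROVED) -/

/-- From Theorem 5.14: if finite clusters `X_k ⊂ L` at scales `ε_k → 0` have rescaled empirical measures
converging weakly-star to `ρ χ_V 𝓛³`, then `P_{W_{φ_hom}}(V) ≤ liminf_k ε_k² F₁(X_k)` for the density
`φ_hom` provided by the theorem. [cite: CicaleseKreutzLeonardi2023, Theorem 5.14 p. 33] -/
theorem periodicGammaLimit_liminf (h : CicaleseKreutzLeonardi2023_periodicGammaLimit)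
    {L : Set (EuclideanSpace ℝ (Fin 3))} {e : Fin 3 → EuclideanSpace ℝ (Fin 3)} {C : ℝ}
    {cnn : EuclideanSpace ℝ (Fin 3) → ℝ} (hL : IsAdmissibleSet L) (he : IsPeriodicSet L e)
    (hc : IsBoundedCoeff C cnn) :
    ∃ φhom : EuclideanSpace ℝ (Fin 3) → ℝ, CellFormulaHolds L cnn φhom ∧
      ∀ (ε : ℕ → ℝ) (X : ℕ → Set (EuclideanSpace ℝ (Fin 3))) (V : Set (EuclideanSpace ℝ (Fin 3))),
        (∀ k, 0 < ε k) → Tendsto ε atTop (𝓝 0) → (∀ k, X k ⊆ L) → MeasurableSet V →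
        EmpiricalMeasuresWeakStarToDensity X ε (density L e) V →
          anisotropicPerimeter (wulffSet φhom) V ≤
            liminf (fun k => scaledNNEnergy (ε k) L cnn (X k)) atTop := by
  obtain ⟨φhom, -, hcell, hli, -⟩ := h L e C cnn hL he hc
  exact ⟨φhom, hcell, fun ε X V hε hε0 hX hV hconv => hli ε X V hε hε0 hX hV hconv⟩

end Literature.MathematicalPhysics.StatisticalMechanics.CicaleseKreutzLeonardi2023

end
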